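import Literature.Analysis.Complex.LogDerivFarFactor
import Literature.Analysis.Complex.LaguerrePolya
import Mathlib.Analysis.SpecialFunctions.Pow.Asymptotics
import HarnessLib

/-!
# The far factor of a real entire function: real data and the size of the error (proved)

Trunk `Literature/Analysis/Complex`, grouping namespace `Literature.Analysis.Complex.KimLee`
(continuation of `LogDerivFarFactor.lean`; support for the genus-one case of Kim–Lee 2021, Thm. 1).

For `F` entire with `F(0) ≠ 0` and a radius `R` write `F = P · G` on `|z| ≤ R` with
`P(z) = ∏_{|u| ≤ R/2} (z − u)^{m(u)}` the zero polynomial of the disc (Mathlib's divisor) and `G` the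
far factor. This file records:

* for a *real* `F` (`F(z̄) = conj F(z)`) the zero data are conjugation-symmetric
  (`divisor_conj`, via the tree's `Obreschkoff.analyticOrderNatAt_conj`), so that
  `∏ (1 − z/u)^{m(u)}` is (the complexification of) a real polynomial (`exists_real_lift_prod_pow`)
  and `β = G'/G(0) = F'/F(0) + Σ m(u)/u` is real (`im_logDeriv_farFactor_zero`);
* `P(z)/P(0) = ∏ (1 − z/u)^{m(u)}` (`eval_prod_one_sub_pow`);
* the size of Titchmarsh's bound for a function of finite order:
  if `|F(z)| ≤ C e^{|z|^ρ}` then `ε(R) = (16/R)(log(B/|F(0)|) + N log 2 + 1) ≤ (16/R)(K + 2R^ρ)` with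
  `B = C e^{R^ρ}`, Jensen's bound `N log 2 ≤ log(max(1,C)/|F(0)|) + R^ρ` for the number of zeros in
  `|z| ≤ R/2` (the tree's `HadamardGenusZero.count_le_of_bound`), and a constant `K`
  (`titchmarshBound_le`); and `(K + 2R^ρ)/R² → 0` for `ρ < 2` (`tendsto_err`).

## References

* Y.-O. Kim, J. Lee, *A note on the zeros of Jensen polynomials*, arXiv:2105.05386, proof of Thm. 1.
* E. C. Titchmarsh, *The Theory of the Riemann Zeta-Function*, §3.9 Lemma α.
-/

noncomputable section

open Complex Filter Metric Set Topology MeromorphicOn Polynomial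
open scoped ComplexConjugate

namespace Literature.Analysis.Complex.KimLee

open Literature.Analysis.Complex.HadamardGenusZero Literature.Analysis.Complex.Obreschkoff

variable {F : ℂ → ℂ}

/-! ### Conjugation symmetry of the zero data of a real entire function -/

/-- A real entire function (`F(z̄) = conj F(z)`) is real on the real axis. [folklore] -/
theorem im_apply_ofReal_eq_zero (hreal : ∀ z, F (conj z) = conj (F z)) (x : ℝ) : (F x).im = 0 := by
  have h := hreal x
  rw [conj_ofReal] at h
  exact conj_eq_iff_im.1 h.symm

/-- The divisor of a disc about `0` of a real entire function is conjugation-invariant. [folklore] -/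
theorem divisor_conj (hF : Differentiable ℂ F) (h0 : F 0 ≠ 0) (hreal : ∀ z, F (conj z) = conj (F z))
    (R₂ : ℝ) (u : ℂ) :
    divisor F (closedBall (0 : ℂ) R₂) (conj u) = divisor F (closedBall (0 : ℂ) R₂) u := by
  by_cases hu : u ∈ closedBall (0 : ℂ) R₂
  · have hu' : conj u ∈ closedBall (0 : ℂ) R₂ := by
      rwa [mem_closedBall_zero_iff, norm_conj, ← mem_closedBall_zero_iff]
    rw [divisor_apply_eq hF h0 _ hu', divisor_apply_eq hF h0 _ hu, analyticOrderNatAt_conj hF h0 hreal]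
  · have hu' : conj u ∉ closedBall (0 : ℂ) R₂ := by
      rwa [mem_closedBall_zero_iff, norm_conj, ← mem_closedBall_zero_iff]
    rw [divisor_apply_of_not_mem _ hu', divisor_apply_of_not_mem _ hu]

/-- Hence the support of the divisor is conjugation-invariant. [folklore] -/
theorem conj_mem_support_iff (hF : Differentiable ℂ F) (h0 : F 0 ≠ 0)
    (hreal : ∀ z, F (conj z) = conj (F z)) (R₂ : ℝ) (u : ℂ) :
    conj u ∈ ((divisor F (closedBall (0 : ℂ) R₂)).finiteSupport (isCompact_closedBall 0 R₂)).toFinset ↔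
      u ∈ ((divisor F (closedBall (0 : ℂ) R₂)).finiteSupport (isCompact_closedBall 0 R₂)).toFinset := by
  rw [Set.Finite.mem_toFinset, Set.Finite.mem_toFinset, Function.mem_support, Function.mem_support,
    divisor_conj hF h0 hreal]

/-- **Real lift.** If `S ⊂ ℂ` and `n : ℂ → ℕ` are conjugation-invariant, then
`∏_{u ∈ S} (1 − u⁻¹ X)^{n(u)}` is the complexification of a real polynomial (all coefficients are
conjugation-invariant; Mathlib's `Polynomial.lifts`). [folklore] -/
theorem exists_real_lift_prod_pow (S : Finset ℂ) (n : ℂ → ℕ) (hS : ∀ u, conj u ∈ S ↔ u ∈ S)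
    (hn : ∀ u, n (conj u) = n u) :
    ∃ q : ℝ[X], q.map (algebraMap ℝ ℂ) = ∏ u ∈ S, (1 - Polynomial.C u⁻¹ * X) ^ n u := by
  set Q : ℂ[X] := ∏ u ∈ S, (1 - Polynomial.C u⁻¹ * X) ^ n u with hQ
  have hconj : Q.map (starRingEnd ℂ) = Q := by
    rw [hQ, Polynomial.map_prod]
    have h1 : ∀ u, ((1 - Polynomial.C u⁻¹ * X) ^ n u : ℂ[X]).map (starRingEnd ℂ) =
        (1 - Polynomial.C (conj u)⁻¹ * X) ^ n u := fun u => by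
      simp [Polynomial.map_pow, Polynomial.map_sub, Polynomial.map_mul, map_inv₀]
    simp only [h1]
    refine Finset.prod_equiv conjAe.toEquiv (fun u => ?_) (fun u _ => ?_)
    · change u ∈ S ↔ conj u ∈ S
      exact (hS u).symm
    · change (1 - Polynomial.C (conj u)⁻¹ * X) ^ n u = (1 - Polynomial.C (conj u)⁻¹ * X) ^ n (conj u)
      rw [hn]
  have hcoef : ∀ k, Q.coeff k ∈ Set.range (algebraMap ℝ ℂ) := fun k => by
    have h := congrArg (fun r : ℂ[X] => r.coeff k) hconj
    simp only [coeff_map] at h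
    obtain ⟨r, hr⟩ := conj_eq_iff_real.1 h
    exact ⟨r, by rw [hr]; rfl⟩
  exact (mem_lifts Q).1 ((lifts_iff_coeff_lifts Q).2 hcoef)

/-- `P(z)/P(0) = ∏ (1 − z/u)^{n(u)}` for the zero polynomial `P(z) = ∏_{u ∈ S} (z − u)^{n(u)}`,
`0 ∉ S`. [folklore] -/
theorem eval_prod_one_sub_pow (S : Finset ℂ) (n : ℂ → ℕ) (hS : ∀ u ∈ S, u ≠ 0) (z : ℂ) :
    ((∏ u ∈ S, (1 - Polynomial.C u⁻¹ * X) ^ n u : ℂ[X])).eval z =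
      (∏ u ∈ S, (z - u) ^ n u) / ∏ u ∈ S, (0 - u) ^ n u := by
  rw [eval_prod, ← Finset.prod_div_distrib]
  refine Finset.prod_congr rfl fun u hu => ?_
  rw [eval_pow, ← div_pow]
  congr 1
  have hu0 := hS u hu
  simp only [eval_sub, eval_one, eval_mul, eval_C, eval_X]
  field_simp
  ring

/-- The zeros of `∏ (1 − u⁻¹ X)^{n(u)}` lie in `S`. [folklore] -/
theorem mem_of_eval_prod_one_sub_pow_eq_zero {S : Finset ℂ} {n : ℂ → ℕ} {z : ℂ}
    (hz : ((∏ u ∈ S, (1 - Polynomial.C u⁻¹ * X) ^ n u : ℂ[X])).eval z = 0) : z ∈ S := by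
  rw [eval_prod, Finset.prod_eq_zero_iff] at hz
  obtain ⟨u, hu, h⟩ := hz
  rw [eval_pow] at h
  rcases Nat.eq_zero_or_pos (n u) with hn0 | hpos
  · rw [hn0, pow_zero] at h; exact absurd h one_ne_zero
  have hb : (1 - Polynomial.C u⁻¹ * X : ℂ[X]).eval z = 0 := (pow_eq_zero_iff hpos.ne').1 h
  simp only [eval_sub, eval_one, eval_mul, eval_C, eval_X] at hb
  by_cases hu0 : u = 0
  · rw [hu0, inv_zero, zero_mul, sub_zero] at hb; exact absurd hb one_ne_zero
  · have : z = u := by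
      have h1 : u⁻¹ * z = 1 := by linear_combination -hb
      calc z = u * (u⁻¹ * z) := by rw [← mul_assoc, mul_inv_cancel₀ hu0, one_mul]
        _ = u := by rw [h1, mul_one]
    rw [this]; exact hu

/-! ### Realness of `β = G'/G(0)` -/

/-- A conjugation-invariant weighted sum `Σ_{u ∈ S} n(u)/u` is real. [folklore] -/
theorem im_sum_div_eq_zero (S : Finset ℂ) (n : ℂ → ℕ) (hS : ∀ u, conj u ∈ S ↔ u ∈ S)
    (hn : ∀ u, n (conj u) = n u) : (∑ u ∈ S, (n u : ℂ) / u).im = 0 := by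
  apply conj_eq_iff_im.1
  rw [map_sum]
  simp only [map_div₀, map_natCast]
  refine Finset.sum_equiv conjAe.toEquiv (fun u => ?_) (fun u _ => ?_)
  · change u ∈ S ↔ conj u ∈ S
    exact (hS u).symm
  · change (n u : ℂ) / conj u = (n (conj u) : ℂ) / conj u
    rw [hn]

/-- **`β = G'/G(0)` is real** for a real entire `F`: `G'/G(0) = F'/F(0) + Σ_u m(u)/u` with `F'(0)`,
`F(0)` real and conjugation-symmetric zero data. [folklore] -/
theorem im_logDeriv_farFactor_zero (hF : Differentiable ℂ F) (h0 : F 0 ≠ 0)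
    (hreal : ∀ z, F (conj z) = conj (F z)) {R : ℝ} (hR : 0 < R) {G : ℂ → ℂ}
    (hG : AnalyticOnNhd ℂ G (closedBall (0 : ℂ) R))
    (hFPG : ∀ z ∈ closedBall (0 : ℂ) R, F z =
      (∏ u ∈ ((divisor F (closedBall (0 : ℂ) (R / 2))).finiteSupport
          (isCompact_closedBall 0 (R / 2))).toFinset,
        (z - u) ^ (divisor F (closedBall (0 : ℂ) (R / 2)) u).toNat) * G z) :
    (logDeriv G 0).im = 0 := by
  classical
  set D := divisor F (closedBall (0 : ℂ) (R / 2)) with hD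
  set S := (D.finiteSupport (isCompact_closedBall 0 (R / 2))).toFinset with hS
  set P : ℂ → ℂ := fun w => ∏ u ∈ S, (w - u) ^ (D u).toNat with hP
  have h0R : (0 : ℂ) ∈ closedBall (0 : ℂ) R := mem_closedBall_self hR.le
  have hPG : F 0 = P 0 * G 0 := hFPG 0 h0R
  have hP0 : P 0 ≠ 0 := fun h => h0 (by rw [hPG, h, zero_mul])
  have hG0 : G 0 ≠ 0 := fun h => h0 (by rw [hPG, h, mul_zero])
  have hev : F =ᶠ[𝓝 0] fun w => P w * G w := by
    filter_upwards [isOpen_ball.mem_nhds (mem_ball_self hR)] with w hw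
      using hFPG w (ball_subset_closedBall hw)
  have hlogF : logDeriv F 0 = logDeriv (fun w => P w * G w) 0 := by
    rw [logDeriv_apply, logDeriv_apply, hev.deriv_eq, hev.eq_of_nhds]
  have hmul := logDeriv_mul (0 : ℂ) hP0 hG0 ((differentiable_prod_pow_sub S _) 0)
    (hG 0 h0R).differentiableAt
  have h0S : ∀ a ∈ S, (0 : ℂ) ≠ a := by
    intro a ha h
    subst h
    exact hP0 ((prod_pow_sub_eq_zero_iff hF).2 ha)
  have hlogP : logDeriv P 0 = -∑ u ∈ S, ((D u).toNat : ℂ) / u := by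
    rw [logDeriv_apply, hP, deriv_prod_pow_sub_div _ h0S, ← Finset.sum_neg_distrib]
    refine Finset.sum_congr rfl fun u _ => ?_
    rw [zero_sub, div_neg]
  have hG_eq : logDeriv G 0 = logDeriv F 0 + ∑ u ∈ S, ((D u).toNat : ℂ) / u := by
    rw [hlogF, hmul, hlogP]; ring
  rw [hG_eq, add_im]
  have h1 : (logDeriv F 0).im = 0 := by
    have him0 : (F 0).im = 0 := by simpa using im_apply_ofReal_eq_zero hreal 0
    have him1 : (deriv F 0).im = 0 := by
      simpa using im_deriv_ofReal hF (im_apply_ofReal_eq_zero hreal) 0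
    have hF0 : F 0 = (((F 0).re : ℝ) : ℂ) := Complex.ext (by simp) (by simp [him0])
    have hF1 : deriv F 0 = (((deriv F 0).re : ℝ) : ℂ) := Complex.ext (by simp) (by simp [him1])
    rw [logDeriv_apply, hF0, hF1, ← ofReal_div, ofReal_im]
  have h2 : (∑ u ∈ S, ((D u).toNat : ℂ) / u).im = 0 :=
    im_sum_div_eq_zero S (fun u => (D u).toNat) (conj_mem_support_iff hF h0 hreal _)
      (fun u => by simp only [hD, divisor_conj hF h0 hreal])
  rw [h1, h2, add_zero]

/-! ### The size of Titchmarsh's bound for a function of finite order -/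

/-- Jensen: `N(R/2) log 2 ≤ log(max(1, C)/|F(0)|) + R^ρ` for `|F(z)| ≤ C e^{|z|^ρ}`, where `N(R/2)` is
the number of zeros of `F` in `|z| ≤ R/2` (the tree's `count_le_of_bound`). [folklore] -/
theorem sum_divisor_mul_log_two_le (hF : Differentiable ℂ F) (h0 : F 0 ≠ 0) {ρ C : ℝ}
    (hgr : ∀ z, ‖F z‖ ≤ C * Real.exp (‖z‖ ^ ρ)) {R : ℝ} (hR : 0 < R) :
    (∑ u ∈ ((divisor F (closedBall (0 : ℂ) (R / 2))).finiteSupport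
        (isCompact_closedBall 0 (R / 2))).toFinset, (divisor F (closedBall (0 : ℂ) (R / 2)) u : ℝ)) *
        Real.log 2 ≤ Real.log (max 1 C / ‖F 0‖) + R ^ ρ := by
  classical
  set D := divisor F (closedBall (0 : ℂ) (R / 2)) with hD
  set S := (D.finiteSupport (isCompact_closedBall 0 (R / 2))).toFinset with hS
  -- the sum is the counting function
  have hsum : (∑ u ∈ S, (D u : ℝ)) = (count hF h0 (R / 2) : ℝ) := by
    have h1 : ∑ᶠ u, D u = ∑ u ∈ S, D u := by
      apply finsum_eq_sum_of_support_subset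
      intro u hu
      simpa [hS, Set.Finite.coe_toFinset] using hu
    have h2 := finsum_divisor_closedBall hF h0 (R / 2)
    rw [h1] at h2
    have : ((∑ u ∈ S, D u : ℤ) : ℝ) = (count hF h0 (R / 2) : ℝ) := by exact_mod_cast h2
    rw [← this]
    push_cast
    rfl
  rw [hsum]
  set M : ℝ := max 1 C * Real.exp (R ^ ρ) with hM
  have hM1 : 1 ≤ M := by
    have : 1 ≤ Real.exp (R ^ ρ) := Real.one_le_exp (by positivity)
    calc (1 : ℝ) = 1 * 1 := by ring
      _ ≤ max 1 C * Real.exp (R ^ ρ) := mul_le_mul (le_max_left _ _) this zero_le_one (by positivity)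
  have hb : ∀ z : ℂ, ‖z‖ = 2 * (R / 2) → ‖F z‖ ≤ M := fun z hz => by
    have hzR : ‖z‖ = R := by rw [hz]; ring
    calc ‖F z‖ ≤ C * Real.exp (‖z‖ ^ ρ) := hgr z
      _ ≤ max 1 C * Real.exp (‖z‖ ^ ρ) := by gcongr; exact le_max_right _ _
      _ = M := by rw [hM, hzR]
  have hc := count_le_of_bound hF h0 (by positivity : 0 < R / 2) hM1 hb
  have hlog2 : 0 < Real.log 2 := Real.log_pos one_lt_two
  have hF0 : 0 < ‖F 0‖ := norm_pos_iff.2 h0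
  have hmaxC : 0 < max 1 C := lt_of_lt_of_le one_pos (le_max_left _ _)
  calc (count hF h0 (R / 2) : ℝ) * Real.log 2 ≤ Real.log (M / ‖F 0‖) / Real.log 2 * Real.log 2 := by
        gcongr
    _ = Real.log (M / ‖F 0‖) := div_mul_cancel₀ _ hlog2.ne'
    _ = Real.log (max 1 C / ‖F 0‖) + R ^ ρ := by
        rw [hM, mul_div_right_comm, Real.log_mul (by positivity) (Real.exp_pos _).ne', Real.log_exp]

/-- **The size of the bound.** For `|F(z)| ≤ C e^{|z|^ρ}` (`ρ ≥ 0`) and `B = C e^{R^ρ}`: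
`(16/R)(log(B/|F(0)|) + N log 2 + 1) ≤ (16/R)(K + 2 R^ρ)` with
`K = log(C/|F(0)|) + log(max(1,C)/|F(0)|) + 1`. [folklore] -/
theorem titchmarshBound_le (hF : Differentiable ℂ F) (h0 : F 0 ≠ 0) {ρ C : ℝ}
    (hgr : ∀ z, ‖F z‖ ≤ C * Real.exp (‖z‖ ^ ρ)) {R : ℝ} (hR : 0 < R) :
    16 / R * (Real.log (C * Real.exp (R ^ ρ) / ‖F 0‖) +
      (∑ u ∈ ((divisor F (closedBall (0 : ℂ) (R / 2))).finiteSupport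
          (isCompact_closedBall 0 (R / 2))).toFinset, (divisor F (closedBall (0 : ℂ) (R / 2)) u : ℝ)) *
        Real.log 2 + 1) ≤
      16 / R * ((Real.log (C / ‖F 0‖) + Real.log (max 1 C / ‖F 0‖) + 1) + 2 * R ^ ρ) := by
  have hF0 : 0 < ‖F 0‖ := norm_pos_iff.2 h0
  have hC : 0 < C := by
    by_contra hC
    push Not at hC
    have h := hgr 0
    have : C * Real.exp (‖(0 : ℂ)‖ ^ ρ) ≤ 0 :=
      mul_nonpos_of_nonpos_of_nonneg hC (Real.exp_pos _).le
    linarith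
  have h1 : Real.log (C * Real.exp (R ^ ρ) / ‖F 0‖) = Real.log (C / ‖F 0‖) + R ^ ρ := by
    rw [mul_div_right_comm, Real.log_mul (by positivity) (Real.exp_pos _).ne', Real.log_exp]
  have h2 := sum_divisor_mul_log_two_le hF h0 hgr hR
  rw [h1]
  apply mul_le_mul_of_nonneg_left _ (by positivity)
  linarith

/-- The error tends to zero: `(K + 2 R^ρ)/R² → 0` as `R → ∞` for `ρ < 2`. [folklore] -/
theorem tendsto_err {ρ : ℝ} (hρ : ρ < 2) (K : ℝ) :
    Tendsto (fun R : ℝ => (K + 2 * R ^ ρ) / R ^ 2) atTop (𝓝 0) := by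
  have h1 : Tendsto (fun R : ℝ => K / R ^ 2) atTop (𝓝 0) :=
    tendsto_const_nhds.div_atTop (tendsto_pow_atTop two_ne_zero)
  have h2 : Tendsto (fun R : ℝ => 2 * R ^ ρ / R ^ 2) atTop (𝓝 0) := by
    have h := (tendsto_rpow_neg_atTop (by linarith : 0 < 2 - ρ)).const_mul 2
    rw [mul_zero] at h
    refine h.congr' ?_
    filter_upwards [eventually_gt_atTop 0] with R hR
    rw [show -(2 - ρ) = ρ - 2 by ring, Real.rpow_sub hR, Real.rpow_two]
    ring
  have := h1.add h2
  rw [add_zero] at this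
  refine this.congr' (Eventually.of_forall fun R => ?_)
  ring

end Literature.Analysis.Complex.KimLee
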